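import Literature.Probability.LatticeModels.MeanFieldDifferentialInequality
import HarnessLib

/-!
# The truncated three-point function of the Ising model in a field as a double current with a depleted magnetisation (Aizenman–Fernández 1986, (3.16) and (3.18))

Topic `Probability/LatticeModels`, namespace `Literature.Probability.LatticeModels`. Sequel of
`MeanFieldDifferentialInequality` (pair sums `currentPairSum` of currents on the ghost graph,
conditioning on the cluster complement `𝒮_b`, Duminil-Copin–Tassion's (2.11)–(2.13)).

For the finite-volume free Ising state `⟨·⟩ = ⟨·⟩^∅_{Λ;β,h}` (`β, h ≥ 0`, tree parametrisation:
couplings `β` on the edges of `G` inside `Λ`, `βh` on the ghost edges) Aizenman–Fernández 1986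
express the truncated correlations with one spin `σ_o` singled out through pairs of currents
`(n₁, n₂)` with `∂n₁ = {o} Δ {x}`, `∂n₂ = ∅`, the event `o ↮ g` and the **depleted** state
`⟨·⟩_{C^c_{n₁+n₂}(o)}` — the Ising system with every bond touching the cluster of `o` removed,
i.e. the free state with field on the set `𝒮_o ∖ {g}` of real vertices not connected to `o`
(Prop. 3.4, (3.13)–(3.14); `S_x(A,B)`). This file proves the two instances used in §5:

* `dctDelta_eq_currentPairSum_depMag` — the one-sided pivotal sum `δ_{x,y}` of
  Duminil-Copin–Tassion (`dctDelta`: sources `{o,g} Δ {x,y}`, `o ↮ g`, `o ↔ x`, `o ↮ y`) equals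
  `∑_{∂n₁ = {o}Δ{x}, ∂n₂ = ∅} w w 𝟙[o ↮ g] ⟨σ_y⟩_{C^c(o)}` (conditioning on `𝒮_o = S`,
  (2.13)/`dctDelta_eq_sum`, and `Z_S({y,g}) = ⟨σ_y⟩_{S∖{g}} Z_S(∅)`);
* `isingCorr_three_sub_eq_depMag` — **(3.16)**: for `x ≠ y`,
  `⟨σ_oσ_xσ_y⟩ - ⟨σ_o⟩⟨σ_xσ_y⟩ = Z⁻² [∑_{∂n₁={o}Δ{x},∂n₂=∅} w w 𝟙[o ↮ g] ⟨σ_y⟩_{C^c(o)} + (x ⇔ y)]`;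
* `isingU3_eq_neg_depletion` — **(3.18)**: for all `o, x, y ∈ Λ`,
  `u₃(o,x,y) = -Z⁻² [∑_{∂n₁={o}Δ{x},∂n₂=∅} w w 𝟙[o ↮ g] (⟨σ_y⟩ - ⟨σ_y⟩_{C^c(o)}) + (x ⇔ y)]`,
  where `u₃ = ⟨σ_oσ_xσ_y⟩ - ⟨σ_oσ_x⟩⟨σ_y⟩ - ⟨σ_oσ_y⟩⟨σ_x⟩ - ⟨σ_xσ_y⟩⟨σ_o⟩ + 2⟨σ_o⟩⟨σ_x⟩⟨σ_y⟩`
  (spin products as `σ_A` of symmetric differences). Since `⟨σ_y⟩_{C^c(o)} ≤ ⟨σ_y⟩` (Griffiths,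
  `depMag_le`), this displays the GHS sign `u₃ ≤ 0` and is the starting point (5.34) of the
  proof of Aizenman–Fernández's Thm. 5.7.

`depMag β h S y` is the depleted magnetisation as a function of the would-be cluster complement
`S ⊆ Λ ∪ {g}`: `⟨σ_y⟩^∅_{S∖{g};β,h}` if `y ∈ S`, else `0`.

## References

* M. Aizenman, R. Fernández, J. Stat. Phys. **44** (1986) 393–454, §3.4: Prop. 3.4, (3.13)–(3.14);
  Cor. 3.5, (3.15)–(3.16); Cor. 3.7, (3.18), pp. 411–415; §5.2, (5.34), p. 435
  [AizenmanFernandezJSP1986] (held: author copy `paper:url-b8cebc3f44bb`).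
* H. Duminil-Copin, V. Tassion, CMP **343** (2016) 725, proof of Lemma 2.6, (2.11)–(2.13)
  (arXiv:1502.03050 numbering) [DuminilCopinTassionCMP2016].

## Mathlib

`ENNReal.mul_right_inj`, `ENNReal.toReal_add/mul/ofReal`, `Finset.sum_congr`, `field_simp`.
-/

noncomputable section

open Finset MeasureTheory
open scoped symmDiff ENNReal

namespace Literature.Probability.LatticeModels

variable {V : Type*} [DecidableEq V]

section Depletion

variable {G : SimpleGraph V} [G.LocallyFinite] {Λ : Finset V}

local notation "Gg" => ghostGraph G Λ
local notation "Λg" => Finset.insertNone Λ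
local notation "Eg" => edgesIn (ghostGraph G Λ) (Finset.insertNone Λ)
local notation "Zg[" θ ", " X "]" =>
  gcurrentZ (ghostGraph G Λ) (Finset.insertNone Λ) θ (edgesIn (ghostGraph G Λ) (Finset.insertNone Λ)) X
local notation "Conn[" m ", " u ", " v "]" =>
  CConn (ghostGraph G Λ) (Finset.insertNone Λ) m (edgesIn (ghostGraph G Λ) (Finset.insertNone Λ)) u v
local notation "∂g" => csources (ghostGraph G Λ) (Finset.insertNone Λ)
local notation "𝒮[" m ", " b "]" => clusterCompl (ghostGraph G Λ) (Finset.insertNone Λ) m b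

/-! ### The depleted magnetisation -/

variable (G) in
/-- **The depleted magnetisation** `⟨σ_y⟩_{C^c(o)}` as a function of the cluster complement
`S = 𝒮_o ⊆ Λ ∪ {g}`: the free Ising one-point function with field on the real vertices of `S` if
`y ∈ S` (all bonds touching the cluster of `o`, ghost bonds included, removed), and `0` if `y` lies
in the cluster (Aizenman–Fernández 1986, (3.13): `⟨σ_B⟩_{C^c_{n₁+n₂}(x)}`, "the coupling constants are
set to zero for bonds not belonging to" the complement). [cite: AizenmanFernandezJSP1986, §3.3–3.4, eqs. (3.10), (3.13), pp. 411–412] -/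
def depMag (β h : ℝ) (S : Finset (Option V)) (y : V) : ℝ :=
  if (some y : Option V) ∈ S then isingCorr G (Finset.eraseNone S) β h .free {y} else 0

/-- `depMag` off `S` vanishes. [folklore] -/
theorem depMag_of_not_mem {β h : ℝ} {S : Finset (Option V)} {y : V} (hy : (some y : Option V) ∉ S) :
    depMag G β h S y = 0 := if_neg hy

/-- `depMag` on `S` is the free one-point function of `S ∖ {g}`. [folklore] -/
theorem depMag_of_mem {β h : ℝ} {S : Finset (Option V)} {y : V} (hy : (some y : Option V) ∈ S) :
    depMag G β h S y = isingCorr G (Finset.eraseNone S) β h .free {y} := if_pos hy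

/-- `0 ≤ ⟨σ_y⟩_{C^c(o)}` (GKS I). [cite: FriedliVelenik2017, Thm. 3.20, eq. (3.21)] -/
theorem depMag_nonneg {β h : ℝ} (hβ : 0 ≤ β) (hh : 0 ≤ h) (S : Finset (Option V)) (y : V) :
    0 ≤ depMag G β h S y := by
  unfold depMag
  split_ifs with hy
  · exact GKSInequalities.gks_one_holds G hβ hh (Or.inl rfl) (singleton_subset_iff.2 (Finset.mem_eraseNone.2 hy))
  · exact le_rfl

/-- **Griffiths**: `⟨σ_y⟩_{C^c(o)} ≤ ⟨σ_y⟩_Λ` for `S ⊆ Λ ∪ {g}` (monotonicity of the free one-point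
function in the volume, with field). [cite: DuminilCopinTassionCMP2016, eq. (2.4) (arXiv:1502.03050 numbering)] -/
theorem depMag_le {β h : ℝ} (hβ : 0 ≤ β) (hh : 0 ≤ h) {S : Finset (Option V)} (hS : S ⊆ Λg) (y : V)
    (hy : y ∈ Λ) : depMag G β h S y ≤ isingCorr G Λ β h .free {y} := by
  unfold depMag
  split_ifs with hyS
  · have hSr : Finset.eraseNone S ⊆ Λ := fun t ht => Finset.some_mem_insertNone.1 (hS (Finset.mem_eraseNone.1 ht))
    exact Literature.Probability.LatticeModels.isingCorr_free_mono_volume_of_gks G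
      (fun G' _ _ _ _ _ _ _ => GKSInequalities.gks_two_holds G') hβ hh
      (singleton_subset_iff.2 (Finset.mem_eraseNone.2 hyS)) hSr
  · exact GKSInequalities.gks_one_holds G hβ hh (Or.inl rfl) (singleton_subset_iff.2 hy)

/-- `⟨σ_A⟩ ≤ 1`. [folklore] -/
theorem isingCorr_le_one' (Λ' : Finset V) (β h : ℝ) (bc : BoundaryCondition V) (A : Finset V) :
    isingCorr G Λ' β h bc A ≤ 1 :=
  (abs_le.1 (abs_isingCorr_le_one G Λ' β h bc A)).2

/-- `⟨σ_y⟩_{C^c(o)} ≤ 1`. [folklore] -/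
theorem depMag_le_one {β h : ℝ} (hβ : 0 ≤ β) (hh : 0 ≤ h) {S : Finset (Option V)} (hS : S ⊆ Λg) (y : V)
    (hy : y ∈ Λ) : depMag G β h S y ≤ 1 :=
  (depMag_le hβ hh hS y hy).trans (isingCorr_le_one' Λ β h .free {y})

/-! ### The depleted magnetisation as a ratio of current sums inside `S` -/

/-- **`Z_S({y}*) = ⟨σ_y⟩_{S∖{g}} · Z_S(∅)`** for `g, y ∈ S ⊆ Λ ∪ {g}` (the random-current representation
(2.2) in the sub-volume `S ∖ {g}`). [cite: DuminilCopinTassionCMP2016, §2.3, eq. (2.2) (arXiv:1502.03050 numbering)] -/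
theorem gcurrentZ_inner_single_eq {β h : ℝ} (hβ : 0 ≤ β) (hh : 0 ≤ h) {S : Finset (Option V)} (hS : S ⊆ Λg)
    (hn : (none : Option V) ∈ S) {y : V} (hy : (some y : Option V) ∈ S) :
    gcurrentZ Gg Λg (ghostCoupling β (β * h)) (edgesIn Gg S) (starSet {y}) =
      ENNReal.ofReal (depMag G β h S y) * gcurrentZ Gg Λg (ghostCoupling β (β * h)) (edgesIn Gg S) ∅ := by
  set θ : Sym2 (Option V) → ℝ := ghostCoupling β (β * h) with hθdef
  have hθ : ∀ e : Sym2 (Option V), 0 ≤ θ e := ghostCoupling_nonneg hβ (mul_nonneg hβ hh)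
  set Sr : Finset V := Finset.eraseNone S with hSr
  have hSeq : S = Finset.insertNone Sr := by
    rw [hSr, Finset.insertNone_eraseNone, insert_eq_of_mem hn]
  have hSrΛ : Sr ⊆ Λ := fun t ht => Finset.some_mem_insertNone.1 (hS (Finset.mem_eraseNone.1 ht))
  have hySr : y ∈ Sr := Finset.mem_eraseNone.2 hy
  rw [depMag_of_mem hy, ← hSr]
  have hrep := isingCorr_free_eq_gcurrentZ_div (G := G) (Λ := Λ) hSrΛ hβ hh (singleton_subset_iff.2 hySr)
  rw [← hSeq] at hrep
  have hfin : ∀ X, gcurrentZ Gg Λg θ (edgesIn Gg S) X ≠ ∞ := fun X => by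
    rw [hSeq]; exact gcurrentZ_ne_top hθ (edgesIn_insertNone_mono hSrΛ) X
  have hpos : 0 < (gcurrentZ Gg Λg θ (edgesIn Gg S) ∅).toReal := by
    rw [hSeq]; exact toReal_gcurrentZ_ghost_empty_pos hSrΛ hθ subset_rfl
  have hne : gcurrentZ Gg Λg θ (edgesIn Gg S) ∅ ≠ 0 := fun h0 => by
    rw [h0, ENNReal.toReal_zero] at hpos; exact lt_irrefl _ hpos
  rw [hrep, ENNReal.ofReal_div_of_pos hpos, ENNReal.ofReal_toReal (hfin _), ENNReal.ofReal_toReal (hfin _),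
    ENNReal.div_mul_cancel hne (hfin _)]

/-! ### `δ_{x,y}` as a pair sum with the depleted magnetisation -/

/-- The side conditions make `o ≠ x`-independent facts: under `Claim1Side o x y S`, the lifted
sources `({o} Δ {x})*` all lie outside `S`. [folklore] -/
theorem filter_starSet_pair_of_claim1Side {o x y : V} {S : Finset (Option V)} (hS : Claim1Side o x y S) :
    (starSet ({o} ∆ {x})).filter (· ∈ S) = ∅ ∧ (starSet ({o} ∆ {x})).filter (· ∉ S) = starSet ({o} ∆ {x}) := by
  obtain ⟨-, -, hoS, hxS⟩ := hS
  have hout : ∀ v ∈ starSet ({o} ∆ {x}), v ∉ S := by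
    intro v hv
    rw [starSet_pair, mem_symmDiff, mem_singleton, mem_singleton] at hv
    rcases hv with ⟨rfl, -⟩ | ⟨rfl, -⟩
    · exact hoS
    · exact hxS
  exact ⟨filter_false_of_mem hout, filter_true_of_mem hout⟩

/-- **`δ_{x,y}` for a fixed cluster complement**: under the side conditions `g, y ∈ S`, `o, x ∉ S`,
`∑_{∂n₁ = (oxy)*, ∂n₂ = ∅} w w 𝟙[𝒮_o = S] = ⟨σ_y⟩_{S∖{g}} ∑_{∂n₁ = ({o}Δ{x})*, ∂n₂ = ∅} w w 𝟙[𝒮_o = S]`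
(factorise both sides on `{𝒮_o = S}` and use `Z_S({y}*) = ⟨σ_y⟩_{S∖{g}} Z_S(∅)`; Aizenman–Fernández
1986, (3.13) with `A = {x}`, `B = {y}`). [cite: AizenmanFernandezJSP1986, §3.4, eq. (3.13), p. 412] [cite: DuminilCopinTassionCMP2016, proof of Lemma 2.6, Claims 1–2 (arXiv:1502.03050 numbering)] -/
theorem currentPairSum_triple_clusterCompl_eq {β h : ℝ} (hβ : 0 ≤ β) (hh : 0 ≤ h) {o x y : V} (ho : o ∈ Λ)
    (hxy : x ≠ y) {S : Finset (Option V)} (hSΛ : S ⊆ Λg) (hS : Claim1Side o x y S) :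
    currentPairSum G Λ (ghostCoupling β (β * h)) (Finset.insertNone ({o} ∆ ({x} ∆ {y}))) ∅
        (fun m => ind (𝒮[m, some o] = S)) =
      ENNReal.ofReal (depMag G β h S y) *
        currentPairSum G Λ (ghostCoupling β (β * h)) (starSet ({o} ∆ {x})) ∅
          (fun m => ind (𝒮[m, some o] = S)) := by
  set θ : Sym2 (Option V) → ℝ := ghostCoupling β (β * h) with hθdef
  have hb : (some o : Option V) ∈ Λg \ S := mem_sdiff.2 ⟨Finset.some_mem_insertNone.2 ho, hS.2.2.1⟩
  rw [currentPairSum_clusterCompl_eq θ hSΛ hb, currentPairSum_clusterCompl_eq θ hSΛ hb,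
    filter_mem_insertNone_triple hxy hS, filter_not_mem_insertNone_triple hxy hS,
    (filter_starSet_pair_of_claim1Side hS).1, (filter_starSet_pair_of_claim1Side hS).2]
  simp only [filter_empty]
  rw [gcurrentZ_inner_single_eq hβ hh hSΛ hS.1 hS.2.1]
  ring

/-- **`δ_{x,y} = ∑_{∂n₁ = ({o}Δ{x})*, ∂n₂ = ∅} w w 𝟙[o ↮ g] ⟨σ_y⟩_{C^c(o)}`** for `o, x, y ∈ Λ`,
`x ≠ y` (Aizenman–Fernández 1986, (3.13)–(3.14) with `A = {x}`, `B = {y}`: conditioning on the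
cluster of `o`). [cite: AizenmanFernandezJSP1986, §3.4, Proposition 3.4, eqs. (3.13)–(3.14), p. 412] -/
theorem dctDelta_eq_currentPairSum_depMag {β h : ℝ} (hβ : 0 ≤ β) (hh : 0 ≤ h) {o x y : V} (ho : o ∈ Λ)
    (hx : x ∈ Λ) (hy : y ∈ Λ) (hxy : x ≠ y) :
    dctDelta G Λ (ghostCoupling β (β * h)) o x y =
      currentPairSum G Λ (ghostCoupling β (β * h)) (starSet ({o} ∆ {x})) ∅
        (fun m => ind (¬Conn[m, some o, none]) * ENNReal.ofReal (depMag G β h (𝒮[m, some o]) y)) := by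
  set θ : Sym2 (Option V) → ℝ := ghostCoupling β (β * h) with hθdef
  set T := (Λg).powerset.filter (Claim1Side o x y) with hT
  rw [dctDelta_eq_sum θ hx hy]
  calc ∑ S ∈ T, currentPairSum G Λ θ (Finset.insertNone ({o} ∆ ({x} ∆ {y}))) ∅ (fun m => ind (𝒮[m, some o] = S))
      = ∑ S ∈ T, currentPairSum G Λ θ (starSet ({o} ∆ {x})) ∅
          (fun m => ENNReal.ofReal (depMag G β h S y) * ind (𝒮[m, some o] = S)) := by
        refine Finset.sum_congr rfl fun S hS => ?_
        rw [currentPairSum_mul_left]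
        exact currentPairSum_triple_clusterCompl_eq hβ hh ho hxy (mem_powerset.1 (mem_filter.1 hS).1)
          (mem_filter.1 hS).2
    _ = currentPairSum G Λ θ (starSet ({o} ∆ {x})) ∅
          (fun m => ∑ S ∈ T, ENNReal.ofReal (depMag G β h S y) * ind (𝒮[m, some o] = S)) := by
        rw [← currentPairSum_finset_sum]
    _ = _ := by
        refine currentPairSum_congr fun n₁ n₂ h1 _ => ?_
        -- the sum over `S` collapses to `S = 𝒮_o(n₁+n₂)` when the side conditions hold there
        set S₀ := 𝒮[n₁ + n₂, some o] with hS₀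
        have hcollapse : ∑ S ∈ T, ENNReal.ofReal (depMag G β h S y) * ind (S₀ = S) =
            ENNReal.ofReal (depMag G β h S₀ y) * ind (S₀ ∈ T) := by
          by_cases hmem : S₀ ∈ T
          · rw [Finset.sum_eq_single_of_mem S₀ hmem (fun S _ hne => by
                rw [ind_of_false (fun h => hne h.symm), mul_zero]),
              ind_of_true rfl, ind_of_true hmem]
          · rw [ind_of_false hmem, mul_zero]
            exact Finset.sum_eq_zero fun S hS => by
              rw [ind_of_false (fun h : S₀ = S => hmem (by rw [h]; exact hS)), mul_zero]
        rw [hcollapse]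
        -- `S₀ ∈ T ↔ o ↮ g ∧ o ↮ y ∧ o ↔ x`; on the sources of `n₁`, `o ↔ x` holds and `o ↮ y ↔ y ∈ S₀`
        have hiff : S₀ ∈ T ↔ ¬Conn[n₁ + n₂, some o, none] ∧ ¬Conn[n₁ + n₂, some o, some y] ∧
            Conn[n₁ + n₂, some o, some x] := by
          rw [hT, mem_filter, hS₀, claim1Side_clusterCompl_iff hx hy]
          exact ⟨fun h => h.2, fun h => ⟨mem_powerset.2 (clusterCompl_subset _ _), h⟩⟩
        have hox : Conn[n₁ + n₂, some o, some x] := by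
          by_cases hox : o = x
          · subst hox; exact Relation.ReflTransGen.refl
          · have hsrc : ∂g n₁ = ({some o} ∆ {some x} : Finset (Option V)) := by rw [h1, starSet_pair]
            exact (cconn_of_csources_eq (fun h => hox (Option.some_injective _ h)) hsrc).mono
              fun e => Nat.le_add_right _ _
        show ENNReal.ofReal (depMag G β h S₀ y) * ind (S₀ ∈ T) =
          ind (¬Conn[n₁ + n₂, some o, none]) * ENNReal.ofReal (depMag G β h S₀ y)
        by_cases hog : Conn[n₁ + n₂, some o, none]
        · rw [ind_of_false (not_not.2 hog), ind_of_false (fun h => (hiff.1 h).1 hog), zero_mul, mul_zero]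
        · rw [ind_of_true hog, one_mul]
          by_cases hoy : Conn[n₁ + n₂, some o, some y]
          · -- `y` lies in the cluster: both sides vanish
            have hyS : (some y : Option V) ∉ S₀ := fun h => (mem_clusterCompl.1 h).2 hoy
            rw [depMag_of_not_mem hyS, ENNReal.ofReal_zero, zero_mul]
          · rw [ind_of_true (hiff.2 ⟨hog, hoy, hox⟩), mul_one]

/-! ### (3.16): `⟨σ_o; σ_xσ_y⟩` -/

/-- Finiteness of the depletion pair sums. [folklore] -/
theorem currentPairSum_depMag_ne_top {β h : ℝ} (hβ : 0 ≤ β) (hh : 0 ≤ h) {o x y : V} (hy : y ∈ Λ)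
    (F : (Eg → ℕ) → ℝ≥0∞) (hF : ∀ m, F m ≤ 1) :
    currentPairSum G Λ (ghostCoupling β (β * h)) (starSet ({o} ∆ {x})) ∅
        (fun m => F m * ENNReal.ofReal (depMag G β h (𝒮[m, some o]) y)) ≠ ∞ := by
  have hθ : ∀ e : Sym2 (Option V), 0 ≤ ghostCoupling β (β * h) e := ghostCoupling_nonneg hβ (mul_nonneg hβ hh)
  refine currentPairSum_ne_top hθ _ _ fun m => ?_
  calc F m * ENNReal.ofReal (depMag G β h (𝒮[m, some o]) y) ≤ 1 * 1 :=
        mul_le_mul' (hF m) (ENNReal.ofReal_le_one.2 (depMag_le_one hβ hh (clusterCompl_subset _ _) y hy))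
    _ = 1 := one_mul _

/-- **Aizenman–Fernández (3.16)**: for the free Ising state with field (`β, h ≥ 0`) and
`o, x, y ∈ Λ`, `x ≠ y`,
`⟨σ_oσ_xσ_y⟩ - ⟨σ_o⟩⟨σ_xσ_y⟩ = Z⁻² [∑_{∂n₁={o}Δ{x}, ∂n₂=∅} w w 𝟙[o ↮ g] ⟨σ_y⟩_{C^c(o)} + (x ⇔ y)]`
(spin products as `σ_A` of the symmetric differences; Duminil-Copin–Tassion's (2.11)–(2.12) give
`Z² (lhs) = δ_{x,y} + δ_{y,x}`, and `dctDelta_eq_currentPairSum_depMag`). [cite: AizenmanFernandezJSP1986, §3.4, Corollary 3.5, eq. (3.16), p. 413] -/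
theorem isingCorr_three_sub_eq_depMag {β h : ℝ} (hβ : 0 ≤ β) (hh : 0 ≤ h) {o x y : V} (ho : o ∈ Λ)
    (hx : x ∈ Λ) (hy : y ∈ Λ) (hxy : x ≠ y) :
    isingCorr G Λ β h .free ({o} ∆ ({x} ∆ {y})) - isingCorr G Λ β h .free {o} * isingCorr G Λ β h .free ({x} ∆ {y}) =
      ((currentPairSum G Λ (ghostCoupling β (β * h)) (starSet ({o} ∆ {x})) ∅
            (fun m => ind (¬Conn[m, some o, none]) * ENNReal.ofReal (depMag G β h (𝒮[m, some o]) y))).toReal +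
        (currentPairSum G Λ (ghostCoupling β (β * h)) (starSet ({o} ∆ {y})) ∅
            (fun m => ind (¬Conn[m, some o, none]) * ENNReal.ofReal (depMag G β h (𝒮[m, some o]) x))).toReal) /
        (Zg[ghostCoupling β (β * h), ∅]).toReal ^ 2 := by
  rw [isingCorr_triple_sub_eq (G := G) (Λ := Λ) hβ hh ho hx hy,
    currentPairSum_notConn_eq_dctDelta_add (G := G) (Λ := Λ) _ hxy,
    dctDelta_eq_currentPairSum_depMag (G := G) (Λ := Λ) hβ hh ho hx hy hxy,
    dctDelta_eq_currentPairSum_depMag (G := G) (Λ := Λ) hβ hh ho hy hx (Ne.symm hxy),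
    ENNReal.toReal_add (currentPairSum_depMag_ne_top hβ hh hy _ fun _ => ind_le_one _)
      (currentPairSum_depMag_ne_top hβ hh hx _ fun _ => ind_le_one _)]

/-! ### (3.18): the truncated three-point function -/

/-- The combination of a depletion sum with `⟨σ_y⟩ Z² ⟨σ_o;σ_x⟩`: in `ℝ≥0∞`,
`∑ w w 𝟙[o ↮ g] ⟨σ_y⟩_{C^c} + ∑ w w 𝟙[o ↮ g] (⟨σ_y⟩ - ⟨σ_y⟩_{C^c}) = ⟨σ_y⟩ ∑ w w 𝟙[o ↮ g]`. [folklore] -/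
theorem currentPairSum_depMag_add_sub {β h : ℝ} (hβ : 0 ≤ β) (hh : 0 ≤ h) {o x y : V} (hy : y ∈ Λ) :
    currentPairSum G Λ (ghostCoupling β (β * h)) (starSet ({o} ∆ {x})) ∅
          (fun m => ind (¬Conn[m, some o, none]) * ENNReal.ofReal (depMag G β h (𝒮[m, some o]) y)) +
        currentPairSum G Λ (ghostCoupling β (β * h)) (starSet ({o} ∆ {x})) ∅
          (fun m => ind (¬Conn[m, some o, none]) *
            ENNReal.ofReal (isingCorr G Λ β h .free {y} - depMag G β h (𝒮[m, some o]) y)) =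
      ENNReal.ofReal (isingCorr G Λ β h .free {y}) *
        currentPairSum G Λ (ghostCoupling β (β * h)) (starSet ({o} ∆ {x})) ∅
          (fun m => ind (¬Conn[m, some o, none])) := by
  rw [← currentPairSum_add, ← currentPairSum_mul_left]
  refine currentPairSum_congr fun n₁ n₂ _ _ => ?_
  have h0 := depMag_nonneg (G := G) hβ hh (𝒮[n₁ + n₂, some o]) y
  have h1 := depMag_le (G := G) (Λ := Λ) hβ hh (clusterCompl_subset (n₁ + n₂) (some o)) y hy
  rw [← mul_add, ← ENNReal.ofReal_add h0 (sub_nonneg.2 h1), add_sub_cancel, mul_comm]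

/-- **(3.18) on the diagonal `y = x`**: both sides equal `-2⟨σ_x⟩⟨σ_o;σ_x⟩` — the depleted
magnetisation of the cluster site `x` vanishes, and `⟨σ_{oxx}⟩ = ⟨σ_o⟩`, `⟨σ_{xx}⟩ = 1`. [cite: AizenmanFernandezJSP1986, §3.4, Corollary 3.7, eq. (3.18), p. 415] -/
theorem isingU3_eq_neg_depletion_diag {β h : ℝ} (hβ : 0 ≤ β) (hh : 0 ≤ h) {o x : V} (ho : o ∈ Λ)
    (hx : x ∈ Λ) :
    isingCorr G Λ β h .free ({o} ∆ ({x} ∆ {x}))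
        - isingCorr G Λ β h .free ({o} ∆ {x}) * isingCorr G Λ β h .free {x}
        - isingCorr G Λ β h .free ({o} ∆ {x}) * isingCorr G Λ β h .free {x}
        - isingCorr G Λ β h .free ({x} ∆ {x}) * isingCorr G Λ β h .free {o}
        + 2 * (isingCorr G Λ β h .free {o} * isingCorr G Λ β h .free {x} * isingCorr G Λ β h .free {x}) =
      -(((currentPairSum G Λ (ghostCoupling β (β * h)) (starSet ({o} ∆ {x})) ∅
            (fun m => ind (¬Conn[m, some o, none]) *
              ENNReal.ofReal (isingCorr G Λ β h .free {x} - depMag G β h (𝒮[m, some o]) x))).toReal +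
        (currentPairSum G Λ (ghostCoupling β (β * h)) (starSet ({o} ∆ {x})) ∅
            (fun m => ind (¬Conn[m, some o, none]) *
              ENNReal.ofReal (isingCorr G Λ β h .free {x} - depMag G β h (𝒮[m, some o]) x))).toReal) /
        (Zg[ghostCoupling β (β * h), ∅]).toReal ^ 2) := by
  set θ : Sym2 (Option V) → ℝ := ghostCoupling β (β * h) with hθdef
  have hθ : ∀ e : Sym2 (Option V), 0 ≤ θ e := ghostCoupling_nonneg hβ (mul_nonneg hβ hh)
  have hZpos : 0 < (Zg[θ, ∅]).toReal := toReal_gcurrentZ_ghost_empty_pos subset_rfl hθ subset_rfl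
  set Mx : ℝ := isingCorr G Λ β h .free {x} with hMx
  have hMx0 : 0 ≤ Mx := GKSInequalities.gks_one_holds G hβ hh (Or.inl rfl) (singleton_subset_iff.2 hx)
  set Bx := currentPairSum G Λ θ (starSet ({o} ∆ {x})) ∅
    (fun m => ind (¬Conn[m, some o, none]) * ENNReal.ofReal (Mx - depMag G β h (𝒮[m, some o]) x)) with hBx
  set Px := currentPairSum G Λ θ (starSet ({o} ∆ {x})) ∅ (fun m => ind (¬Conn[m, some o, none])) with hPx
  -- the depleted magnetisation of `x` vanishes on the sources `{o} Δ {x}`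
  have hB : Bx = ENNReal.ofReal Mx * Px := by
    rw [hBx, hPx, ← currentPairSum_mul_left]
    refine currentPairSum_congr fun n₁ n₂ h1 _ => ?_
    have hxS : (some x : Option V) ∉ 𝒮[n₁ + n₂, some o] := by
      intro hmem
      have hox : Conn[n₁ + n₂, some o, some x] := by
        by_cases hox : o = x
        · subst hox; exact Relation.ReflTransGen.refl
        · have hsrc : ∂g n₁ = ({some o} ∆ {some x} : Finset (Option V)) := by rw [h1, starSet_pair]
          exact (cconn_of_csources_eq (fun h => hox (Option.some_injective _ h)) hsrc).mono
            fun e => Nat.le_add_right _ _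
      exact (mem_clusterCompl.1 hmem).2 hox
    rw [depMag_of_not_mem hxS, sub_zero, mul_comm]
  have hBreal : Bx.toReal = Mx * Px.toReal := by
    rw [hB, ENNReal.toReal_mul, ENNReal.toReal_ofReal hMx0]
  have h15x : isingCorr G Λ β h .free ({o} ∆ {x}) - isingCorr G Λ β h .free {o} * Mx =
      Px.toReal / (Zg[θ, ∅]).toReal ^ 2 := isingCorr_pair_sub_eq hβ hh ho hx
  have hempty : isingCorr G Λ β h .free (∅ : Finset V) = 1 := by
    have hfun : (spinProduct (∅ : Finset V) : SpinConfig V → ℝ) = fun _ => 1 :=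
      funext fun ω => spinProduct_empty ω
    rw [isingCorr, hfun]
    exact isingExpect_const G Λ β h .free 1
  have e1 : ({x} ∆ {x} : Finset V) = ∅ := symmDiff_self _
  have e2 : ({o} ∆ ∅ : Finset V) = {o} := symmDiff_bot _
  rw [e1, e2, hempty, hBreal]
  have hZ2 : (Zg[θ, ∅]).toReal ^ 2 ≠ 0 := pow_ne_zero 2 hZpos.ne'
  have e15 : Px.toReal = (isingCorr G Λ β h .free ({o} ∆ {x}) - isingCorr G Λ β h .free {o} * Mx) *
      (Zg[θ, ∅]).toReal ^ 2 := by
    rw [h15x, div_mul_cancel₀ _ hZ2]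
  rw [e15]
  field_simp
  ring

/-- **Aizenman–Fernández (3.18), the truncated three-point function as a depletion**: for the
free Ising state with field (`β, h ≥ 0`) and all `o, x, y ∈ Λ`,
`u₃(o,x,y) = -Z⁻² [∑_{∂n₁={o}Δ{x},∂n₂=∅} w w 𝟙[o ↮ g] (⟨σ_y⟩ - ⟨σ_y⟩_{C^c(o)}) + (x ⇔ y)]` with
`u₃ = ⟨σ_oσ_xσ_y⟩ - ⟨σ_oσ_x⟩⟨σ_y⟩ - ⟨σ_oσ_y⟩⟨σ_x⟩ - ⟨σ_xσ_y⟩⟨σ_o⟩ + 2⟨σ_o⟩⟨σ_x⟩⟨σ_y⟩` (spin products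
as `σ_A` of symmetric differences, so coincidences are allowed). For `x ≠ y` this is (3.16) minus
`⟨σ_y⟩`·(3.15) minus `⟨σ_x⟩`·(3.15); for `x = y` both sides equal `-2⟨σ_x⟩⟨σ_o;σ_x⟩`
(`isingU3_eq_neg_depletion_diag`). As `⟨σ_y⟩_{C^c(o)} ≤ ⟨σ_y⟩`, this exhibits `u₃ ≤ 0` (GHS) and
is the representation (5.34) behind Thm. 5.7. [cite: AizenmanFernandezJSP1986, §3.4, Corollary 3.7, eq. (3.18), p. 415, and §5.2, eq. (5.34), p. 435] -/
theorem isingU3_eq_neg_depletion {β h : ℝ} (hβ : 0 ≤ β) (hh : 0 ≤ h) {o x y : V} (ho : o ∈ Λ)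
    (hx : x ∈ Λ) (hy : y ∈ Λ) :
    isingCorr G Λ β h .free ({o} ∆ ({x} ∆ {y}))
        - isingCorr G Λ β h .free ({o} ∆ {x}) * isingCorr G Λ β h .free {y}
        - isingCorr G Λ β h .free ({o} ∆ {y}) * isingCorr G Λ β h .free {x}
        - isingCorr G Λ β h .free ({x} ∆ {y}) * isingCorr G Λ β h .free {o}
        + 2 * (isingCorr G Λ β h .free {o} * isingCorr G Λ β h .free {x} * isingCorr G Λ β h .free {y}) =
      -(((currentPairSum G Λ (ghostCoupling β (β * h)) (starSet ({o} ∆ {x})) ∅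
            (fun m => ind (¬Conn[m, some o, none]) *
              ENNReal.ofReal (isingCorr G Λ β h .free {y} - depMag G β h (𝒮[m, some o]) y))).toReal +
        (currentPairSum G Λ (ghostCoupling β (β * h)) (starSet ({o} ∆ {y})) ∅
            (fun m => ind (¬Conn[m, some o, none]) *
              ENNReal.ofReal (isingCorr G Λ β h .free {x} - depMag G β h (𝒮[m, some o]) x))).toReal) /
        (Zg[ghostCoupling β (β * h), ∅]).toReal ^ 2) := by
  by_cases hxy : x = y
  · subst hxy; exact isingU3_eq_neg_depletion_diag hβ hh ho hx
  set θ : Sym2 (Option V) → ℝ := ghostCoupling β (β * h) with hθdef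
  have hθ : ∀ e : Sym2 (Option V), 0 ≤ θ e := ghostCoupling_nonneg hβ (mul_nonneg hβ hh)
  have hZpos : 0 < (Zg[θ, ∅]).toReal := toReal_gcurrentZ_ghost_empty_pos subset_rfl hθ subset_rfl
  set My : ℝ := isingCorr G Λ β h .free {y} with hMy
  set Mx : ℝ := isingCorr G Λ β h .free {x} with hMx
  have hMy0 : 0 ≤ My := GKSInequalities.gks_one_holds G hβ hh (Or.inl rfl) (singleton_subset_iff.2 hy)
  have hMx0 : 0 ≤ Mx := GKSInequalities.gks_one_holds G hβ hh (Or.inl rfl) (singleton_subset_iff.2 hx)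
  set Ay := currentPairSum G Λ θ (starSet ({o} ∆ {x})) ∅
    (fun m => ind (¬Conn[m, some o, none]) * ENNReal.ofReal (depMag G β h (𝒮[m, some o]) y)) with hAy
  set By := currentPairSum G Λ θ (starSet ({o} ∆ {x})) ∅
    (fun m => ind (¬Conn[m, some o, none]) * ENNReal.ofReal (My - depMag G β h (𝒮[m, some o]) y)) with hBy
  set Py := currentPairSum G Λ θ (starSet ({o} ∆ {x})) ∅ (fun m => ind (¬Conn[m, some o, none])) with hPy
  set Ax := currentPairSum G Λ θ (starSet ({o} ∆ {y})) ∅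
    (fun m => ind (¬Conn[m, some o, none]) * ENNReal.ofReal (depMag G β h (𝒮[m, some o]) x)) with hAx
  set Bx := currentPairSum G Λ θ (starSet ({o} ∆ {y})) ∅
    (fun m => ind (¬Conn[m, some o, none]) * ENNReal.ofReal (Mx - depMag G β h (𝒮[m, some o]) x)) with hBx
  set Px := currentPairSum G Λ θ (starSet ({o} ∆ {y})) ∅ (fun m => ind (¬Conn[m, some o, none])) with hPx
  have hAy_ne : Ay ≠ ∞ := currentPairSum_depMag_ne_top hβ hh hy _ fun _ => ind_le_one _
  have hAx_ne : Ax ≠ ∞ := currentPairSum_depMag_ne_top hβ hh hx _ fun _ => ind_le_one _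
  have hB_ne : ∀ {t : V} (_ : t ∈ Λ) (X : Finset (Option V)),
      currentPairSum G Λ θ X ∅ (fun m => ind (¬Conn[m, some o, none]) *
        ENNReal.ofReal (isingCorr G Λ β h .free {t} - depMag G β h (𝒮[m, some o]) t)) ≠ ∞ := by
    intro t ht X
    refine currentPairSum_ne_top hθ _ _ fun m => ?_
    refine le_trans (mul_le_mul' (ind_le_one _) le_rfl) ?_
    rw [one_mul]
    refine ENNReal.ofReal_le_one.2 ?_
    linarith [depMag_nonneg (G := G) hβ hh (𝒮[m, some o]) t, isingCorr_le_one' (G := G) Λ β h .free {t}]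
  have hBy_ne : By ≠ ∞ := hB_ne hy _
  have hBx_ne : Bx ≠ ∞ := hB_ne hx _
  -- `Ay + By = My · Py`, `Ax + Bx = Mx · Px` in `ℝ`
  have hy_rel : Ay.toReal + By.toReal = My * Py.toReal := by
    have := congrArg ENNReal.toReal (currentPairSum_depMag_add_sub (G := G) (Λ := Λ) (o := o) (x := x) hβ hh hy)
    rwa [ENNReal.toReal_add hAy_ne hBy_ne, ENNReal.toReal_mul, ENNReal.toReal_ofReal hMy0] at this
  have hx_rel : Ax.toReal + Bx.toReal = Mx * Px.toReal := by
    have := congrArg ENNReal.toReal (currentPairSum_depMag_add_sub (G := G) (Λ := Λ) (o := o) (x := y) hβ hh hx)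
    rwa [ENNReal.toReal_add hAx_ne hBx_ne, ENNReal.toReal_mul, ENNReal.toReal_ofReal hMx0] at this
  -- the two-point identities (3.15) and (3.16)
  have h15x : isingCorr G Λ β h .free ({o} ∆ {x}) - isingCorr G Λ β h .free {o} * Mx = Py.toReal / (Zg[θ, ∅]).toReal ^ 2 :=
    isingCorr_pair_sub_eq hβ hh ho hx
  have h15y : isingCorr G Λ β h .free ({o} ∆ {y}) - isingCorr G Λ β h .free {o} * My = Px.toReal / (Zg[θ, ∅]).toReal ^ 2 :=
    isingCorr_pair_sub_eq hβ hh ho hy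
  have h16 : isingCorr G Λ β h .free ({o} ∆ ({x} ∆ {y})) - isingCorr G Λ β h .free {o} * isingCorr G Λ β h .free ({x} ∆ {y}) =
      (Ay.toReal + Ax.toReal) / (Zg[θ, ∅]).toReal ^ 2 :=
    isingCorr_three_sub_eq_depMag hβ hh ho hx hy hxy
  have halg : isingCorr G Λ β h .free ({o} ∆ ({x} ∆ {y}))
      - isingCorr G Λ β h .free ({o} ∆ {x}) * My
      - isingCorr G Λ β h .free ({o} ∆ {y}) * Mx
      - isingCorr G Λ β h .free ({x} ∆ {y}) * isingCorr G Λ β h .free {o}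
      + 2 * (isingCorr G Λ β h .free {o} * Mx * My) =
      (isingCorr G Λ β h .free ({o} ∆ ({x} ∆ {y})) - isingCorr G Λ β h .free {o} * isingCorr G Λ β h .free ({x} ∆ {y}))
        - My * (isingCorr G Λ β h .free ({o} ∆ {x}) - isingCorr G Λ β h .free {o} * Mx)
        - Mx * (isingCorr G Λ β h .free ({o} ∆ {y}) - isingCorr G Λ β h .free {o} * My) := by ring
  rw [halg, h16, h15x, h15y]
  have eAy : Ay.toReal = My * Py.toReal - By.toReal := by linarith
  have eAx : Ax.toReal = Mx * Px.toReal - Bx.toReal := by linarith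
  rw [eAy, eAx]
  ring

end Depletion

end Literature.Probability.LatticeModels
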